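import Summits.KontsevichZagierPeriods.Zeta5Search.RecordRayDescentData
import HarnessLib

/-!
# The `P̂`-side denominator law on Brown–Zudilin's RECORD ray: `2·d_{14n}·d_{15n}·d_{25n}·P̂_n ∈ ℤ` for every `n ≥ 1`,
and the census's W-XS1 laws there (cell `pub-zeta5`, seat ct-1 g46)

HONEST FRAMING: systematic search; no irrationality claim unless certified.  INTEGRALITY of the dictionary `ζ(3)`-numerator
`P̂(n·a) = ρ(UV′ − U′V)` (`XSave.PhatOf`) on the ray `a = (8,16,10,15,12,16,18,13)` of Brown–Zudilin's Theorem 1 (arXiv:2210.03391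
Sect. 11); nothing here concerns the arithmetic nature of `ζ(5)`/`ζ(3)`; the `P`-side (28)/(30), the worthiness `0.86597135…` and every
`γ` are NOT touched; records in print UNMOVED; net named-fact debt 0.  Theorems only (0 `def`).

OUR work (Summit side): the instance of `DescentPhatDenominatorsBox.two_mul_PhatOf_isInt` at the record ray with
`D = d_{14n}·d_{15n}·d_{25n}`.  The companions of (22) there are Rhin–Viola's `I(14n, 29n−κ, 16n, 15n, κ−n, κ−2n, κ−3n, 12n)`,
`κ ∈ [18n, 26n]`, with integers (2.8) `(κ, 12n, κ−n, 13n, 13n, 15n, 14n, 14n)`, so Theorem 2.1 gives `d_κ·d_{κ−n}·d_{15n}`; the weight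
`w_κ = ±C(κ,12n)C(8n,κ−18n)C(16n,κ−13n)` carries `d_κ ∣ d_{14n}·C(κ,12n)` (Kummer, `max(12n, κ−12n) ≤ 14n`), and `d_{κ−n} ∣ d_{25n}`:

* **`two_mul_lcm_record_PhatOf_isInt`** — `∃ z : ℤ, z = 2·d_{14n}·d_{15n}·d_{25n}·P̂(n·a)` for every `n ≥ 1` and every partner
  `j ∈ [1,7]` (so no prime `> 25n` divides den `P̂(n·a)`, and a prime in `(15n, 25n]` at most once, in `(14n,15n]` at most twice);
* **`XS1_noPrimeBeyondD_record`**, **`XS1_windowExponentLeOne_record`** — the census's conjectured W-XS1 laws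
  (`XSave.XS1_noPrimeBeyondD`: no prime beyond `max(m₁n, d n) = 25n`; `XSave.XS1_windowExponentLeOne`: an odd prime beyond
  `m₁n = 18n` divides den `P̂` at most once) SPECIALISED TO `a = (8,16,10,15,12,16,18,13)`, every `n ≥ 1`, every partner, literally.
How far `d_{14n}d_{15n}d_{25n}` sits above the true denominator of `P̂(n·a)` below `14n` is NOT claimed (the census's tables are
`P`-side); the statement is a valid all-`n` bound, the first off the diagonal.
-/

noncomputable section

open Finset

namespace Summit.KontsevichZagierPeriods.Zeta5Search.RecordRayPhatDenominators

open Literature.NumberTheory.Irrationality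
open Literature.NumberTheory.Irrationality.BrownZudilin2022 (w22 pOf qOf bOfA Converges)
open Literature.NumberTheory.Irrationality.RhinViola2001 (Params d)
open Literature.NumberTheory.Irrationality.RhinViola2001.Theorem21 (Dom)
open Summit.KontsevichZagierPeriods.Zeta5Search.WedgeDictionary (dOf)
open Summit.KontsevichZagierPeriods.Zeta5Search.XSave (PhatOf InRegion m1Of)
open Summit.KontsevichZagierPeriods.Zeta5Search.DescentPhatDenominatorsBox (two_mul_PhatOf_isInt)
open Summit.KontsevichZagierPeriods.Zeta5Search.SymmetricPhatXSave (padicValNat_lcmUpto log_eq_zero_of_lt)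
open Summit.KontsevichZagierPeriods.Zeta5Search.RecordRayDescentData

/-! ### The divisibility supplied by the weights -/

/-- For `18n ≤ k ≤ 26n`: `d_k·d_{k−n}·d_{15n} ∣ (d_{14n}·d_{15n}·d_{25n})·C(k,12n)` (Kummer at `m = 12n`, `max(12n,k−12n) ≤ 14n`;
`k − n ≤ 25n`). -/
theorem lcm_triple_dvd (n k : ℕ) (h1 : 18 * n ≤ k) (h2 : k ≤ 26 * n) :
    Nat.lcmUpto k * Nat.lcmUpto (k - n) * Nat.lcmUpto (15 * n) ∣
      Nat.lcmUpto (14 * n) * Nat.lcmUpto (15 * n) * Nat.lcmUpto (25 * n) * k.choose (12 * n) := by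
  have hK := lcmUpto_dvd_lcmUpto_max_mul_choose (show 12 * n ≤ k by omega)
  have hmax : max (12 * n) (k - 12 * n) ≤ 14 * n := max_le (by omega) (by omega)
  have h14 : Nat.lcmUpto k ∣ Nat.lcmUpto (14 * n) * k.choose (12 * n) :=
    hK.trans (mul_dvd_mul_right (Literature.NumberTheory.LFunctions.lcmUpto_dvd_lcmUpto_of_le hmax) _)
  have h25 : Nat.lcmUpto (k - n) ∣ Nat.lcmUpto (25 * n) := Literature.NumberTheory.LFunctions.lcmUpto_dvd_lcmUpto_of_le (by omega)
  calc Nat.lcmUpto k * Nat.lcmUpto (k - n) * Nat.lcmUpto (15 * n)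
      ∣ (Nat.lcmUpto (14 * n) * k.choose (12 * n)) * Nat.lcmUpto (25 * n) * Nat.lcmUpto (15 * n) :=
        mul_dvd_mul (mul_dvd_mul h14 h25) dvd_rfl
    _ = Nat.lcmUpto (14 * n) * Nat.lcmUpto (15 * n) * Nat.lcmUpto (25 * n) * k.choose (12 * n) := by ring

/-! ### The theorem -/

/-- **`2·d_{14n}·d_{15n}·d_{25n}·P̂(n·a) ∈ ℤ` on the record ray `a = (8,16,10,15,12,16,18,13)`, every `n ≥ 1`, every partner
`j ∈ [1,7]`.** -/
theorem two_mul_lcm_record_PhatOf_isInt (n : ℕ) (hn : 1 ≤ n) (j : ℕ) (hj : j ∈ Icc 1 7) :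
    ∃ z : ℤ, (z : ℚ) = 2 * ((Nat.lcmUpto (14 * n) * Nat.lcmUpto (15 * n) * Nat.lcmUpto (25 * n) : ℕ) : ℚ) *
      PhatOf (n • (![8, 16, 10, 15, 12, 16, 18, 13] : Fin 8 → ℤ)) j := by
  obtain ⟨⟨_, hconv, hreg, hd, hpart⟩, h2b, hp, hres, hcl2⟩ := inBox_rec n hn j hj
  refine two_mul_PhatOf_isInt _ j hj hconv hreg hd hpart h2b hp hres hcl2 _ fun κ hκ _ => ?_
  rw [pOf_rec, qOf_rec] at hκ ⊢
  simp only [Matrix.cons_val, mem_Icc] at hκ ⊢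
  refine ⟨κ, κ - n, 15 * n, (companion_dom_rec n κ hκ.1 (by omega)).1, (companion_dom_rec n κ hκ.1 (by omega)).2, ?_⟩
  -- the divisibility `d_κ d_{κ−n} d_{15n} ∣ D·w_κ`, with `κ = k` a natural number
  obtain ⟨k, rfl⟩ : ∃ k : ℕ, κ = k := ⟨κ.toNat, (Int.toNat_of_nonneg (by omega)).symm⟩
  have hk1 : 18 * n ≤ k := by exact_mod_cast hκ.1
  have hk2 : k ≤ 26 * n := by have := hκ.2; omega
  have hw := w22_rec n k hk1 hk2
  rw [pOf_rec, qOf_rec] at hw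
  rw [hw]
  have hd1 : d (k : ℤ) = Nat.lcmUpto k := by simp only [d, Int.toNat_natCast]
  have hd2 : d ((k : ℤ) - n) = Nat.lcmUpto (k - n) := by
    rw [show (k : ℤ) - n = ((k - n : ℕ) : ℤ) by omega]; simp only [d, Int.toNat_natCast]
  have hd3 : d (15 * (n : ℤ)) = Nat.lcmUpto (15 * n) := by
    rw [show (15 * (n : ℤ)) = ((15 * n : ℕ) : ℤ) by push_cast; ring]; simp only [d, Int.toNat_natCast]
  rw [hd1, hd2, hd3]
  have hX : ((Nat.lcmUpto k * Nat.lcmUpto (k - n) * Nat.lcmUpto (15 * n) : ℕ) : ℤ) ∣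
      ((Nat.lcmUpto (14 * n) * Nat.lcmUpto (15 * n) * Nat.lcmUpto (25 * n) * k.choose (12 * n) *
        ((8 * n).choose (k - 18 * n) * (16 * n).choose (k - 13 * n)) : ℕ) : ℤ) :=
    Int.natCast_dvd_natCast.2 ((lcm_triple_dvd n k hk1 hk2).mul_right _)
  have hEq : ((Nat.lcmUpto (14 * n) * Nat.lcmUpto (15 * n) * Nat.lcmUpto (25 * n) : ℕ) : ℤ) *
      ((-1) ^ (43 * n + k) * ((k.choose (12 * n) : ℕ) : ℤ) * (((8 * n).choose (k - 18 * n) : ℕ) : ℤ) *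
        (((16 * n).choose (k - 13 * n) : ℕ) : ℤ)) =
      (-1) ^ (43 * n + k) * ((Nat.lcmUpto (14 * n) * Nat.lcmUpto (15 * n) * Nat.lcmUpto (25 * n) * k.choose (12 * n) *
        ((8 * n).choose (k - 18 * n) * (16 * n).choose (k - 13 * n)) : ℕ) : ℤ) := by
    push_cast; ring
  rw [hEq]
  exact dvd_mul_of_dvd_right hX _

/-! ### Valuations and the census's W-XS1 laws on the record ray -/

/-- From `z = N·X` with `N ≠ 0`: `v_p(X) ≥ −v_p(N)`. -/
theorem neg_padicValNat_le_padicValRat {p : ℕ} [hp : Fact p.Prime] {N : ℕ} (hN : N ≠ 0) {X : ℚ}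
    (h : ∃ z : ℤ, (z : ℚ) = (N : ℚ) * X) : -(padicValNat p N : ℤ) ≤ padicValRat p X := by
  obtain ⟨z, hz⟩ := h
  have hN' : (N : ℚ) ≠ 0 := Nat.cast_ne_zero.2 hN
  have hX : X = (z : ℚ) / (N : ℚ) := by rw [eq_div_iff hN', hz]; ring
  by_cases hz0 : z = 0
  · rw [hX, hz0]; simp
  rw [hX, padicValRat.div (by exact_mod_cast hz0) hN', padicValRat.of_int, padicValRat.of_nat]
  have : (0 : ℤ) ≤ padicValInt p z := by positivity
  linarith

/-- `v_p(P̂(n·a)) ≥ −(v_p(2) + ⌊log_p 14n⌋ + ⌊log_p 15n⌋ + ⌊log_p 25n⌋)` on the record ray (every prime, `n ≥ 1`, `j ∈ [1,7]`). -/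
theorem padicValRat_PhatOf_record_ge {p : ℕ} [hp : Fact p.Prime] (n : ℕ) (hn : 1 ≤ n) (j : ℕ) (hj : j ∈ Icc 1 7) :
    -((padicValNat p 2 + Nat.log p (14 * n) + Nat.log p (15 * n) + Nat.log p (25 * n) : ℕ) : ℤ) ≤
      padicValRat p (PhatOf (n • (![8, 16, 10, 15, 12, 16, 18, 13] : Fin 8 → ℤ)) j) := by
  have hD : 2 * (Nat.lcmUpto (14 * n) * Nat.lcmUpto (15 * n) * Nat.lcmUpto (25 * n)) ≠ 0 :=
    mul_ne_zero two_ne_zero (mul_ne_zero (mul_ne_zero (Nat.lcmUpto_ne_zero _) (Nat.lcmUpto_ne_zero _)) (Nat.lcmUpto_ne_zero _))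
  have h := neg_padicValNat_le_padicValRat (p := p) hD (X := PhatOf (n • (![8, 16, 10, 15, 12, 16, 18, 13] : Fin 8 → ℤ)) j)
    (by obtain ⟨z, hz⟩ := two_mul_lcm_record_PhatOf_isInt n hn j hj; exact ⟨z, by rw [hz]; push_cast; ring⟩)
  rw [padicValNat.mul two_ne_zero (mul_ne_zero (mul_ne_zero (Nat.lcmUpto_ne_zero _) (Nat.lcmUpto_ne_zero _))
      (Nat.lcmUpto_ne_zero _)), padicValNat.mul (mul_ne_zero (Nat.lcmUpto_ne_zero _) (Nat.lcmUpto_ne_zero _))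
      (Nat.lcmUpto_ne_zero _), padicValNat.mul (Nat.lcmUpto_ne_zero _) (Nat.lcmUpto_ne_zero _),
    padicValNat_lcmUpto hp.out, padicValNat_lcmUpto hp.out, padicValNat_lcmUpto hp.out] at h
  push_cast at h ⊢
  linarith

/-- **W-XS1, upper half, on the record ray**: the body of `XSave.XS1_noPrimeBeyondD` at `a = (8,16,10,15,12,16,18,13)`:
no prime beyond `d(b(n·a)) = 25n` divides den `P̂(n·a)` (every `n ≥ 1`, every partner). -/
theorem XS1_noPrimeBeyondD_record :
    ∀ (j n p : ℕ), 1 ≤ n → InRegion (n • (![8, 16, 10, 15, 12, 16, 18, 13] : Fin 8 → ℤ)) j → p.Prime →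
      m1Of (n • (![8, 16, 10, 15, 12, 16, 18, 13] : Fin 8 → ℤ)) < p →
      dOf (bOfA (n • (![8, 16, 10, 15, 12, 16, 18, 13] : Fin 8 → ℤ))) < p →
      0 ≤ padicValRat p (PhatOf (n • (![8, 16, 10, 15, 12, 16, 18, 13] : Fin 8 → ℤ)) j) := by
  intro j n p hn hR hp _ hd
  haveI : Fact p.Prime := ⟨hp⟩
  rw [dOf_rec] at hd
  have hd' : 25 * n < p := by exact_mod_cast hd
  have h := padicValRat_PhatOf_record_ge (p := p) n hn j hR.1
  rw [log_eq_zero_of_lt (by omega : 14 * n < p), log_eq_zero_of_lt (by omega : 15 * n < p), log_eq_zero_of_lt hd',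
    padicValNat.eq_zero_of_not_dvd (show ¬ p ∣ 2 from fun h2 => by have := Nat.le_of_dvd (by norm_num) h2; omega)] at h
  simpa using h

/-- `⌊log_p 25n⌋ ≤ 1` for a prime `p > 18n ≥ 18` (`25n < p²`). -/
theorem log_twentyfive_le_one {p n : ℕ} (hp : p.Prime) (hn : 1 ≤ n) (h : 18 * n < p) : Nat.log p (25 * n) ≤ 1 := by
  have hlt : 25 * n < p ^ 2 := by nlinarith [hp.two_le]
  have := (Nat.log_lt_iff_lt_pow hp.one_lt (by omega : 25 * n ≠ 0)).2 hlt
  omega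

/-- **W-XS1, window half, on the record ray**: the body of `XSave.XS1_windowExponentLeOne` at `a = (8,16,10,15,12,16,18,13)`:
an odd prime beyond `m₁(n·a) = 18n` divides den `P̂(n·a)` at most once. -/
theorem XS1_windowExponentLeOne_record :
    ∀ (j n p : ℕ), 1 ≤ n → InRegion (n • (![8, 16, 10, 15, 12, 16, 18, 13] : Fin 8 → ℤ)) j → p.Prime → p ≠ 2 →
      m1Of (n • (![8, 16, 10, 15, 12, 16, 18, 13] : Fin 8 → ℤ)) < p →
      -1 ≤ padicValRat p (PhatOf (n • (![8, 16, 10, 15, 12, 16, 18, 13] : Fin 8 → ℤ)) j) := by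
  intro j n p hn hR hp hp2 hm
  haveI : Fact p.Prime := ⟨hp⟩
  rw [m1Of_rec] at hm
  have hm' : 18 * n < p := by exact_mod_cast hm
  have h := padicValRat_PhatOf_record_ge (p := p) n hn j hR.1
  have hlog := log_twentyfive_le_one hp hn hm'
  rw [log_eq_zero_of_lt (by omega : 14 * n < p), log_eq_zero_of_lt (by omega : 15 * n < p),
    padicValNat.eq_zero_of_not_dvd (show ¬ p ∣ 2 from fun h2 => hp2 ((Nat.prime_dvd_prime_iff_eq hp Nat.prime_two).1 h2))]
    at h
  push_cast at h
  omega

end Summit.KontsevichZagierPeriods.Zeta5Search.RecordRayPhatDenominators
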